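/-
Origin: expansion seat `prover-pub-hodgecm-mc-binder-2-g8-0`, handover #22 20:40Z md5 b448d10f90ca (233 l.; the SIX 𝒯-free fields of pv06's `ArchC.HypSmoothSide` in the currency of a `wm` input: record **`HypSideW (W₀ : WmInput V D) jT kind lam hlam m₁ m₂`** = {`FinIdx`, `ins : FinIdx → 𝓕_print →ₗ[ℂ] 𝒮(𝔸_F^ι)`, `ins_mem : ins f φ ∈ W₀.SK` (J-x₀), `dense` (𝒮^κ ⊆ Θ-closure of the span of the inserted pure tensors, in Weil's `ThetaTop` of `W₀.ρ`) (J-dense), `omg_ins : W₀.ρ (1, W₀.eW (jT (ιc t))) (ins f φ) = ins f (ω_T t φ)` at the printed torus point `printedTorusHom kind lam hlam (jT ∘ toAdeles) (pinnedVacs kind m₁ m₂) t` (J-T)/(J-omg), `e : b → HypIdx (kind b) → ℝ → U(W)(𝔸)`, `e_zero`, `smooth` (slope of `ω` along `e_b` → `ins f (hypX ⟨b,u⟩ φ)` in `ThetaTop`) (J-smooth)}, bundled form `HypCoreW W₀ jT m₁ m₂` (+ decEq/kind/lam/hlam); §1b the same six fields PROVED for the Weil theta model `wmOf' hP W₀`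 (canonical instances): `val_wmOf'_omg` (ω(y)Φ = W₀.ρ (1, W₀.eW y) Φ), `insM` (linear, values in `↥(wmOf' hP W₀).SK`), `dense_insM` (Subtype.dense_iff), `omg_insM` (regime `hW : IsAnisotropic L D.gramW`, through `regimeLift L D.gramW jT`), `eM`/`omg_eM_zero`, `tendsto_SK_iff`, `smooth_insM`; mirror rc 0 / 0 warn / 28.5 s) (`HOME/mc/pub-hodgecm-mc-binder-2/g8/pkg/HodgeCM/Model/HypCensus/SideW.lean`, md5 b448d10f, 233 lines);
landed by the gen-13 packager (p-g13) in gate run 37 as `HodgeCM/Model/HypCensus/SideW.lean` (verbatim).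
-/
/-
Origin: speedrun cell pub-hodgecm, MODEL-CONSTRUCTION sub-cell, lineage mc-binder-2 (BINDER-OWNERS rows 18/19: E binders
`hyp12` / `hyp34` of `Model.perL_picardCM_r15A`), seat prover-pub-hodgecm-mc-binder-2-g8-0 (gen 8), 2026-08-19.
Target in PKG: `HodgeCM/Model/HypCensus/SideW.lean` (NEW additive leaf; imports `Model/WmInstance` (RUN 35) and
`PerL34/ArchCHyperbolicSide` (RUN 31) only).  KERNEL ONLY: 0 records, nothing cited, 0 `def … : Prop`; the junction
statements are FIELDS of the record `HypSideW` (hypotheses of the theorems of the sibling leaf `HypCensus/SideE`).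
-/
import Summits.HodgeConjecture.HodgeCM.Model.WmInstance
import Summits.HodgeConjecture.HodgeCM.PerL34.ArchCHyperbolicSide

/-!
# The six 𝒯-free fields of the hyperbolic side in the currency of a `wm` input `W₀ : WmInput V D`

pv06's `ArchC.HypSmoothSide` (PKG `PerL34/ArchCHyperbolicSide`, the content of E's binders `hyp12`/`hyp34`) has six fields
`FinIdx / ins / dense / omg_ins / e / smooth` over the END-STATE core of a theta model.  For the theta models E builds from a
`wm` input (`wmOf' hP W₀`, mc-unitary-1 `Model/WmInstance`), this file states the same six fields on `W₀` ALONE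
(**`HypSideW`**, §1) and proves them for the Weil theta model `wmOf' hP W₀` (§1b: `insM`, `dense_insM`, `omg_insM`, `eM`,
`smooth_insM` — the model's `𝒮^κ = ↥W₀.SK` with the subspace topology of Weil's `ThetaTop`, its `ω(y) = W₀.ρ (1, W₀.eW y)`).
The sibling leaf `HypCensus/SideE` carries them through `coreOf / toCore / ThetaModel.ofRegCarrier` to E's pin and proves
E's `hyp12`/`hyp34` VERBATIM from one `HypCoreW (W V c) …` per good sextic context.

Dictionary: `ins` lands in `𝒮(𝔸_F^ι)` with values in `W₀.SK` ((J-x₀)); `ω(t)` at the printed torus point is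
`W₀.ρ (1, W₀.eW (jT (ιc t)))` read through pv11 `printedTorusHom` / `placesCoord` / `placesEquiv` and pv07 `toAdeles`
((J-T12)/(J-T34): `jT := D.jT₁₂` / `D.jT₃₄`); the curves `e_b` run in `U(W)(𝔸) = adelicUnitaryGroup L D.gramW` and pass
through `1` at `s = 0`; `dense` / `smooth` are stated in Weil's `Θ`-initial topology `ThetaTop` of `W₀.ρ`.
Nothing here is a claim of PerL/QW8: every statement below is proved; the junctions are hypotheses (record fields).
-/

set_option autoImplicit false

noncomputable section

open scoped TensorProduct InnerProductSpace Matrix Topology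
open Filter

namespace HodgeCM.Model.HypCensus

open HodgeCM HodgeCM.Model HodgeCM.Adelic
open HodgeCM.PerL34 HodgeCM.PerL34.ArchC HodgeCM.PerL34.Fock HodgeCM.PerL34.Fock.PrintDict
open Literature.NumberTheory.Automorphic (piSchwartzBruhat)
open Literature.NumberTheory.Weil1964 (repWeilThetaDatum)
open NumberField NumberField.SeesawArchTorus

/-! ## §1 The six-field side record in the currency of a `wm` input -/

section SideW

variable {L : CMField} {ι₁ : L →+* ℂ} {V : HermSpace3 L ι₁} {D : StubTree.SeesawDatum L}

/-- Weil's `Θ`-initial topology carrier of the representation `W₀.ρ` (the END STATE's `S(X_A)`, §2). -/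
abbrev thetaTopOf (W₀ : WmInput V D) : Type :=
  (repWeilThetaDatum W₀.F W₀.ι W₀.ρ
    (((W₀.ΓU.prod W₀.Γ : Subgroup (W₀.GU × W₀.G)) : Set (W₀.GU × W₀.G)))).ThetaTop

/-- the identity `𝒮(𝔸_F^ι) → ThetaTop` (Weil's `toThetaTop`, an `Equiv.refl`). -/
abbrev toTop (W₀ : WmInput V D) : ↥(piSchwartzBruhat W₀.F W₀.ι) → thetaTopOf W₀ :=
  (repWeilThetaDatum W₀.F W₀.ι W₀.ρ
    (((W₀.ΓU.prod W₀.Γ : Subgroup (W₀.GU × W₀.G)) : Set (W₀.GU × W₀.G)))).toThetaTop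

/-- `ω(y) := W₀.ρ (1, W₀.eW y)` on `𝒮(𝔸_F^ι)`, `y ∈ U(W)(𝔸)` (the END STATE's `ω`, §2). -/
abbrev omgW (W₀ : WmInput V D) (y : adelicUnitaryGroup L D.gramW) :
    ↥(piSchwartzBruhat W₀.F W₀.ι) → ↥(piSchwartzBruhat W₀.F W₀.ι) :=
  fun Φ => ((W₀.ρ (1, W₀.eW y) : Module.End ℂ ↥(piSchwartzBruhat W₀.F W₀.ι))) Φ

/-- **The six 𝒯-free fields of pv06's `ArchC.HypSmoothSide`, in the currency of a `wm` input `W₀ : WmInput V D`**, for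
the torus embedding `jT` (`D.jT₁₂` or `D.jT₃₄`), kinds / scalings of the infinite places and typed weight exponents
`(m₁, m₂)` (the vacuum characters are the PINNED ones, `pinnedVacs kind m₁ m₂`). -/
structure HypSideW (W₀ : WmInput V D)
    (jT : SeesawTorus (maximalRealSubfield (L : Type)) (L : Type) →ₜ* adelicUnitaryGroup L D.gramW)
    [DecidableEq (InfinitePlace (L : Type))] (kind : InfinitePlace (L : Type) → PlaceKind)
    (lam : InfinitePlace (L : Type) → ℂ) (hlam : ∀ w, lam w ≠ 0) (m₁ m₂ : InfinitePlace (L : Type) → ℤ) where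
  /-- [SETUP D4] index of the finite data `Φ_f`. -/
  FinIdx : Type
  /-- [SETUP D4] the printed insertion `φ ↦ E(φ_∞ ⊗ Φ_f)`, linear in `φ`, into `𝒮(𝔸_F^ι)` … -/
  ins : FinIdx → (printPlaces (InfinitePlace (L : Type)) kind lam hlam (pinnedVacs kind m₁ m₂)).F →ₗ[ℂ]
    ↥(piSchwartzBruhat W₀.F W₀.ι)
  /-- … with values in `𝒮^κ = W₀.SK` ((J-x₀)). -/
  ins_mem : ∀ (f : FinIdx) (φ : (printPlaces (InfinitePlace (L : Type)) kind lam hlam (pinnedVacs kind m₁ m₂)).F),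
    ins f φ ∈ W₀.SK
  /-- [SETUP D4/D5, (J-dense)] `𝒮^κ` lies in the `Θ`-closure of the span of the inserted pure tensors. -/
  dense : ∀ Φ ∈ W₀.SK, toTop W₀ Φ ∈ closure (toTop W₀ ''
    (Submodule.span ℂ (Set.range fun q : FinIdx ×
      (printPlaces (InfinitePlace (L : Type)) kind lam hlam (pinnedVacs kind m₁ m₂)).F => ins q.1 q.2) :
        Set ↥(piSchwartzBruhat W₀.F W₀.ι)))
  /-- [SETUP D4, (J-T)/(J-omg)] `ω(ι_T t)(φ ⊗ Φ_f) = (ω_∞(t)φ) ⊗ Φ_f` at the printed torus point. -/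
  omg_ins : ∀ (f : FinIdx) (t : (printPlaces (InfinitePlace (L : Type)) kind lam hlam (pinnedVacs kind m₁ m₂)).Tg)
    (φ : (printPlaces (InfinitePlace (L : Type)) kind lam hlam (pinnedVacs kind m₁ m₂)).F),
    omgW W₀ (printedTorusHom kind lam hlam (jT.toMonoidHom.comp (toAdeles (L : Type))) (pinnedVacs kind m₁ m₂) t)
      (ins f φ) = ins f ((printPlaces (InfinitePlace (L : Type)) kind lam hlam (pinnedVacs kind m₁ m₂)).ωT t φ)
  /-- [SETUP D4, (J-smooth)] one curve `e_b : ℝ → U(W)(𝔸)` per `Σ₁₂` place … -/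
  e : (b : InfinitePlace (L : Type)) → HypIdx (kind b) → ℝ → adelicUnitaryGroup L D.gramW
  /-- … through `1` at `s = 0` … -/
  e_zero : ∀ (b : InfinitePlace (L : Type)) (u : HypIdx (kind b)), e b u 0 = 1
  /-- … along which `φ ⊗ Φ_f` is a `C¹` vector of `ω` with derivative `(H^{(b)}φ) ⊗ Φ_f`, IN WEIL'S `Θ`-TOPOLOGY. -/
  smooth : ∀ (b : InfinitePlace (L : Type)) (u : HypIdx (kind b)) (f : FinIdx)
    (φ : (printPlaces (InfinitePlace (L : Type)) kind lam hlam (pinnedVacs kind m₁ m₂)).F),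
    Tendsto (fun s : ℝ => ((s : ℝ) : ℂ)⁻¹ • (toTop W₀ (omgW W₀ (e b u s) (ins f φ)) - toTop W₀ (ins f φ)))
      (𝓝[≠] 0) (𝓝 (toTop W₀ (ins f (hypX (InfinitePlace (L : Type)) kind lam hlam (pinnedVacs kind m₁ m₂) ⟨b, u⟩ φ))))

/-- The same with the kind map and the scalings bundled (the shape of `HypSmoothCore12/34`). -/
structure HypCoreW (W₀ : WmInput V D)
    (jT : SeesawTorus (maximalRealSubfield (L : Type)) (L : Type) →ₜ* adelicUnitaryGroup L D.gramW)
    (m₁ m₂ : InfinitePlace (L : Type) → ℤ) where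
  [decEq : DecidableEq (InfinitePlace (L : Type))]
  kind : InfinitePlace (L : Type) → PlaceKind
  lam : InfinitePlace (L : Type) → ℂ
  hlam : ∀ w, lam w ≠ 0
  side : HypSideW W₀ jT kind lam hlam m₁ m₂

end SideW

/-- A span transports along a `Subtype.val`-compatible family: every element of `span (range ins)` is the value of an
element of `span (range insE)` (`insE = ⟨ins, mem⟩`). -/
theorem exists_span_val_eq {M : Type*} [AddCommGroup M] [Module ℂ M] {N : Type*} [AddCommGroup N] [Module ℂ N]
    (v : N →ₗ[ℂ] M) {I : Type*} (g : I → N) (x : M) (hx : x ∈ Submodule.span ℂ (Set.range fun i => v (g i))) :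
    ∃ y ∈ Submodule.span ℂ (Set.range g), v y = x := by
  induction hx using Submodule.span_induction with
  | mem x hx =>
    obtain ⟨i, rfl⟩ := hx
    exact ⟨g i, Submodule.subset_span ⟨i, rfl⟩, rfl⟩
  | zero => exact ⟨0, Submodule.zero_mem _, map_zero v⟩
  | add x y _ _ hx hy =>
    obtain ⟨a, ha, rfl⟩ := hx
    obtain ⟨b, hb, rfl⟩ := hy
    exact ⟨a + b, Submodule.add_mem _ ha hb, map_add v a b⟩
  | smul a x _ hx =>
    obtain ⟨y, hy, rfl⟩ := hx
    exact ⟨a • y, Submodule.smul_mem _ a hy, map_smul v a y⟩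


/-! ## §1b The same six fields on the Weil theta model `wmOf' hP W₀` (canonical instances) -/

section MLevel

variable (hP : PrintFact_unitaryCompact)
variable {L : CMField} {ι₁ : L →+* ℂ} {V : HermSpace3 L ι₁} {D : StubTree.SeesawDatum L} (W₀ : WmInput V D)
  (jT : SeesawTorus (maximalRealSubfield (L : Type)) (L : Type) →ₜ* adelicUnitaryGroup L D.gramW)
  [DecidableEq (InfinitePlace (L : Type))] (kind : InfinitePlace (L : Type) → PlaceKind)
  (lam : InfinitePlace (L : Type) → ℂ) (hlam : ∀ w, lam w ≠ 0) (m₁ m₂ : InfinitePlace (L : Type) → ℤ)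
  (A : HypSideW W₀ jT kind lam hlam m₁ m₂)

omit [DecidableEq (InfinitePlace (L : Type))] in
/-- `ω(y)Φ` of `wmOf' hP W₀` on values: `W₀.ρ (1, W₀.eW y) Φ` (`rfl` up to `map_one`). -/
theorem val_wmOf'_omg (y : ↥(regimeSubgroup L D.gramW)) (Φ : ↥(wmOf' hP W₀).SK) :
    Subtype.val ((wmOf' hP W₀).omg y Φ) = omgW W₀ (Subtype.val y) (Subtype.val Φ) := by
  change ((W₀.ρ (W₀.eV (Subtype.val (1 : ↥(regimeSubgroup L V.Hm))), W₀.eW (Subtype.val y)) :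
        Module.End ℂ ↥(piSchwartzBruhat W₀.F W₀.ι))) Φ.1 = _
  rw [OneMemClass.coe_one, map_one]

/-- The printed insertion with values in `𝒮^κ = ↥(wmOf' hP W₀).SK`, as a linear map. -/
def insM (f : A.FinIdx) :
    (printPlaces (InfinitePlace (L : Type)) kind lam hlam (pinnedVacs kind m₁ m₂)).F →ₗ[ℂ] ↥(wmOf' hP W₀).SK where
  toFun φ := ⟨A.ins f φ, A.ins_mem f φ⟩
  map_add' φ ψ := Subtype.ext (by
    rw [WeilThetaModel.coe_add]
    exact map_add (A.ins f) φ ψ)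
  map_smul' a φ := Subtype.ext (by
    rw [WeilThetaModel.coe_smul]
    exact map_smul (A.ins f) a φ)

/-- (Ported verbatim from the HodgeCMPerL package; no docstring in the source.) -/
@[simp] theorem val_insM (f : A.FinIdx)
    (φ : (printPlaces (InfinitePlace (L : Type)) kind lam hlam (pinnedVacs kind m₁ m₂)).F) :
    Subtype.val (insM hP W₀ jT kind lam hlam m₁ m₂ A f φ) = A.ins f φ := rfl

/-- (J-dense) on the model: the inserted pure tensors span a dense subspace of `𝒮^κ` (subspace topology of `ThetaTop`). -/
theorem dense_insM : Dense (Submodule.span ℂ (Set.range fun q : A.FinIdx ×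
      (printPlaces (InfinitePlace (L : Type)) kind lam hlam (pinnedVacs kind m₁ m₂)).F =>
        insM hP W₀ jT kind lam hlam m₁ m₂ A q.1 q.2) : Set ↥(wmOf' hP W₀).SK) := by
  rw [Subtype.dense_iff]
  intro Φ hΦ
  refine closure_mono ?_ (A.dense Φ hΦ)
  rintro _ ⟨x, hx, rfl⟩
  obtain ⟨y, hy, hyx⟩ := exists_span_val_eq ((wmOf' hP W₀).SKvalₗ)
    (fun q : A.FinIdx × _ => insM hP W₀ jT kind lam hlam m₁ m₂ A q.1 q.2) x hx
  exact ⟨y, hy, hyx⟩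

/-- (J-T)/(J-omg) on the model (regime of `U(W)`): `ω` at the printed torus point through the regime lift of `jT`. -/
theorem omg_insM (hW : IsAnisotropic L D.gramW) (f : A.FinIdx)
    (t : (printPlaces (InfinitePlace (L : Type)) kind lam hlam (pinnedVacs kind m₁ m₂)).Tg)
    (φ : (printPlaces (InfinitePlace (L : Type)) kind lam hlam (pinnedVacs kind m₁ m₂)).F) :
    (wmOf' hP W₀).omg (printedTorusHom kind lam hlam ((regimeLift L D.gramW jT).toMonoidHom.comp (toAdeles (L : Type)))
        (pinnedVacs kind m₁ m₂) t) (insM hP W₀ jT kind lam hlam m₁ m₂ A f φ) =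
      insM hP W₀ jT kind lam hlam m₁ m₂ A f
        ((printPlaces (InfinitePlace (L : Type)) kind lam hlam (pinnedVacs kind m₁ m₂)).ωT t φ) := by
  apply Subtype.ext
  rw [val_wmOf'_omg, val_insM, val_insM]
  have hj : Subtype.val (printedTorusHom kind lam hlam ((regimeLift L D.gramW jT).toMonoidHom.comp (toAdeles (L : Type)))
      (pinnedVacs kind m₁ m₂) t) = printedTorusHom kind lam hlam (jT.toMonoidHom.comp (toAdeles (L : Type)))
      (pinnedVacs kind m₁ m₂) t :=
    coe_regimeLift_apply hW jT _
  rw [hj]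
  exact A.omg_ins f t φ

/-- the curves `e_b` lifted into the regime model group. -/
def eM (hW : IsAnisotropic L D.gramW) (b : InfinitePlace (L : Type)) (u : HypIdx (kind b)) (s : ℝ) :
    ↥(regimeSubgroup L D.gramW) :=
  regimeEquivHom L D.gramW hW (A.e b u s)

/-- (Ported verbatim from the HodgeCMPerL package; no docstring in the source.) -/
theorem omg_eM_zero (hW : IsAnisotropic L D.gramW) (b : InfinitePlace (L : Type)) (u : HypIdx (kind b))
    (Φ : ↥(wmOf' hP W₀).SK) : (wmOf' hP W₀).omg (eM W₀ jT kind lam hlam m₁ m₂ A hW b u 0) Φ = Φ := by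
  apply Subtype.ext
  rw [val_wmOf'_omg, eM, coe_regimeEquivHom, A.e_zero]
  change ((W₀.ρ (1, W₀.eW 1) : Module.End ℂ ↥(piSchwartzBruhat W₀.F W₀.ι))) Φ.1 = Φ.1
  rw [map_one, ← Prod.one_eq_mk, map_one]
  rfl

omit [DecidableEq (InfinitePlace (L : Type))] in
/-- limits in `𝒮^κ` are limits of values in `ThetaTop` (the subspace topology). -/
theorem tendsto_SK_iff {α : Type*} {l : Filter α} (F : α → ↥(wmOf' hP W₀).SK) (y : ↥(wmOf' hP W₀).SK) :
    Tendsto F l (𝓝 y) ↔ Tendsto (fun a => Subtype.val (F a)) l (𝓝 (Subtype.val y)) :=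
  Topology.IsEmbedding.subtypeVal.tendsto_nhds_iff

/-- (J-smooth) on the model: the slope of `ω` along `e_b` at `φ ⊗ Φ_f` converges to `(H^{(b)}φ) ⊗ Φ_f` in `𝒮^κ`. -/
theorem smooth_insM (hW : IsAnisotropic L D.gramW) (b : InfinitePlace (L : Type)) (u : HypIdx (kind b)) (f : A.FinIdx)
    (φ : (printPlaces (InfinitePlace (L : Type)) kind lam hlam (pinnedVacs kind m₁ m₂)).F) :
    Tendsto (fun s : ℝ => ((s : ℝ) : ℂ)⁻¹ •
        ((wmOf' hP W₀).omg (eM W₀ jT kind lam hlam m₁ m₂ A hW b u s) (insM hP W₀ jT kind lam hlam m₁ m₂ A f φ) -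
          (wmOf' hP W₀).omg (eM W₀ jT kind lam hlam m₁ m₂ A hW b u 0) (insM hP W₀ jT kind lam hlam m₁ m₂ A f φ)))
      (𝓝[≠] 0)
      (𝓝 (insM hP W₀ jT kind lam hlam m₁ m₂ A f
        (hypX (InfinitePlace (L : Type)) kind lam hlam (pinnedVacs kind m₁ m₂) ⟨b, u⟩ φ))) := by
  rw [tendsto_SK_iff]
  refine (A.smooth b u f φ).congr fun s => ?_
  simp only [omg_eM_zero]
  rw [WeilThetaModel.coe_smul, WeilThetaModel.coe_sub, val_wmOf'_omg, val_insM]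
  rfl

end MLevel


end HodgeCM.Model.HypCensus

end
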